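import Summits.CriticalPhenomena.PercolationContinuityZ3.Theorems.PercNearOneGluingNoHeavyLowerTailSahiCTCC2LevelTwo
import HarnessLib

/-!
# `NoHeavyLowerTail` (crux stmt-CriticalPhenomena-4575), P3 lane: the FOUR-POINT INEQUALITY behind row 3 of the level-3 monotonicity C2 —
# Kleitman surpluses on the small cubes of a 4-set `{v, d₁, d₂, d₃}` dominate the common 2-subsets (kernel-checked finite case analysis)

Support file (seat `prim-l12-p3`, gen 43; `--supports stmt-CriticalPhenomena-4575`).  Memo
`run/shared/lean/prim/prim-l12/FROM-prim-l12-p3-g43-C2-LEVEL-THREE.md` §4.  For up-sets `𝒳, 𝒵 ⊆ 2^α` and four distinct points `v, d₁, d₂, d₃`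
(`Q₀ = {d₁,d₂,d₃}`, `Q = Q₀ + v`, `κ = kap 𝒳 𝒵` the Kleitman surplus of `…SahiCTCKleitmanSurplus`):
    `κ(Q₀,{v}) + Σ_d κ(Q₀−d, {v,d}) + Σ_d κ({v,d}, Q₀−d) + Σ_y ([Q₀−y ∈ 𝒳][yv ∈ 𝒵] + [Q₀−y ∈ 𝒵][yv ∈ 𝒳]) ≥ #{e ⊆ Q : #e = 2, e ∈ 𝒳 ∩ 𝒵}`
(**`fourPoint_nonneg`**).  This is exactly the coefficient `[s^{2·1_{Q₀}+2e_v}] R_3 − [s^{2·1_{Q₀}+3e_v}] R_3` for a pair on the four points (memo §4: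
all 28 224 pairs of up-sets on 4 points; value `= (1−x_{Q₀})(1−z_{Q₀}) + Σ_{(f,f')}[f ∉ 𝒳][f' ∉ 𝒵] + c·n₀ − a'b'` with the counting lemma
`Σ_{(f,f')} ≥ a'b'`), and by the monotonicity of `κ` in the free set it gives row 3 (three doubled points) of C2 at level 3 for every number of
single points (`…SahiCTCC2ThreeRowThree`).  PROOF HERE: the inequality only reads the memberships of the eleven subsets of `Q` of size `≥ 2`;
`κ` on a free set of one or two points is an explicit signed count of memberships (`kap_free_singleton`, `kap_free_pair`); the `114` monotone
membership patterns are listed (`validMasks`, completeness `validMasks_complete` by `decide +kernel` over the `2^11` bit masks) and the inequality is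
checked on all `114²` pairs of patterns (`val4_nonneg_of_mem`, `decide +kernel`).  Nothing is asserted about the crux.
-/

noncomputable section

open scoped Classical

namespace Summit.CriticalPhenomena.PercolationContinuityZ3.Theorems.SahiCTCForms

open Finset MvPolynomial SahiCTCGenFun

variable {α : Type*} [DecidableEq α]

/-! ### Kleitman surpluses on free sets of one and two points -/

section SmallCubes
variable (F G : Finset (Finset α)) {D : Finset α} {u u' : α}

/-- `κ` as a signed sum over the sub-cube: `kap 𝒳 𝒵 D s = Σ_{U ⊆ s} ([D∪U ∈ 𝒳∩𝒵] − [D∪U ∈ 𝒳][D∪(s∖U) ∈ 𝒵])`. [this work] -/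
theorem kap_eq_sum_powerset (D s : Finset α) :
    kap F G D s = ∑ U ∈ s.powerset, ((if D ∪ U ∈ F ∧ D ∪ U ∈ G then (1 : ℤ) else 0)
      - (if D ∪ U ∈ F ∧ D ∪ (s \ U) ∈ G then (1 : ℤ) else 0)) := by
  unfold kap
  rw [sum_sub_distrib]
  congr 1
  · rw [← tr_inter]
    unfold tr
    rw [card_filter]
    push_cast
    refine sum_congr rfl fun U _ => ?_
    simp only [mem_inter]
  · unfold tr
    rw [filter_filter, card_filter]
    push_cast
    refine sum_congr rfl fun U hU => ?_
    have hsub : s \ U ⊆ s := sdiff_subset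
    simp only [mem_filter, mem_powerset, hsub, true_and]

/-- **`κ` on a one-point free set**: `κ(D,{u}) = [D ∈ C] + [D+u ∈ C] − [D ∈ 𝒳][D+u ∈ 𝒵] − [D+u ∈ 𝒳][D ∈ 𝒵]` (`C = 𝒳 ∩ 𝒵`). [this work] -/
theorem kap_free_singleton (D : Finset α) (u : α) :
    kap F G D {u} = (if D ∈ F ∧ D ∈ G then (1 : ℤ) else 0) + (if insert u D ∈ F ∧ insert u D ∈ G then (1 : ℤ) else 0)
      - (if D ∈ F ∧ insert u D ∈ G then (1 : ℤ) else 0) - (if insert u D ∈ F ∧ D ∈ G then (1 : ℤ) else 0) := by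
  rw [kap_eq_sum_powerset, show ({u} : Finset α) = insert u ∅ from rfl, sum_powerset_insert (notMem_empty u), powerset_empty,
    sum_singleton, sum_singleton, insert_empty]
  have e1 : D ∪ {u} = insert u D := by rw [union_comm, ← insert_eq]
  rw [union_empty, sdiff_empty, e1, sdiff_self, bot_eq_empty, union_empty]
  ring

/-- **`κ` on a two-point free set** (`u ≠ u'`): the eight signed memberships. [this work] -/
theorem kap_free_pair (D : Finset α) (huu' : u ≠ u') :
    kap F G D {u, u'} =
      (if D ∈ F ∧ D ∈ G then (1 : ℤ) else 0) + (if insert u D ∈ F ∧ insert u D ∈ G then (1 : ℤ) else 0)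
      + (if insert u' D ∈ F ∧ insert u' D ∈ G then (1 : ℤ) else 0)
      + (if insert u (insert u' D) ∈ F ∧ insert u (insert u' D) ∈ G then (1 : ℤ) else 0)
      - (if D ∈ F ∧ insert u (insert u' D) ∈ G then (1 : ℤ) else 0)
      - (if insert u D ∈ F ∧ insert u' D ∈ G then (1 : ℤ) else 0)
      - (if insert u' D ∈ F ∧ insert u D ∈ G then (1 : ℤ) else 0)
      - (if insert u (insert u' D) ∈ F ∧ D ∈ G then (1 : ℤ) else 0) := by
  have hu : u ∉ ({u'} : Finset α) := fun h => huu' (mem_singleton.1 h)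
  have hs1 : ∀ g : Finset α → ℤ, ∑ t ∈ ({u'} : Finset α).powerset, g t = g ∅ + g {u'} := fun g => by
    rw [show ({u'} : Finset α) = insert u' ∅ from rfl, sum_powerset_insert (notMem_empty u'), powerset_empty, sum_singleton,
      sum_singleton, insert_empty]
  rw [kap_eq_sum_powerset, show ({u, u'} : Finset α) = insert u {u'} from rfl, sum_powerset_insert hu, hs1, hs1, insert_empty]
  -- the four free sets and their complements inside `{u, u'}`
  have e1 : D ∪ {u} = insert u D := by rw [union_comm, ← insert_eq]
  have e2 : D ∪ {u'} = insert u' D := by rw [union_comm, ← insert_eq]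
  have e3 : D ∪ insert u {u'} = insert u (insert u' D) := by
    rw [union_comm, insert_eq, insert_eq, insert_eq, union_assoc]
  have c1 : (insert u {u'} : Finset α) \ {u} = {u'} := by
    ext x; simp only [mem_sdiff, mem_insert, mem_singleton]
    constructor
    · rintro ⟨h | h, hne⟩
      · exact absurd h hne
      · exact h
    · rintro rfl; exact ⟨Or.inr rfl, fun h => huu' h.symm⟩
  have c2 : (insert u {u'} : Finset α) \ {u'} = {u} := by
    ext x; simp only [mem_sdiff, mem_insert, mem_singleton]
    constructor
    · rintro ⟨h | h, hne⟩
      · exact h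
      · exact absurd h hne
    · rintro rfl; exact ⟨Or.inl rfl, huu'⟩
  rw [union_empty, sdiff_empty, c2, c1, sdiff_self, bot_eq_empty, union_empty, e3, e2, e1]
  ring

end SmallCubes

/-! ### The finite check: 114 monotone membership patterns of the eleven large subsets of a 4-set -/

namespace FourPt

/-- Bit `i` of `a` and bit `j` of `b` both set, as `0/1`. [this work] -/
def cc (a b : ℕ) (i j : ℕ) : ℤ := if a.testBit i && b.testBit j then 1 else 0

/-- The four-point functional on membership patterns.  Bits: `0:{d₁,d₂} 1:{d₁,d₃} 2:{d₂,d₃} 3:{v,d₁} 4:{v,d₂} 5:{v,d₃} 6:{d₁,d₂,d₃}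
7:{v,d₂,d₃} 8:{v,d₁,d₃} 9:{v,d₁,d₂} 10:Q` (`a` for `𝒳`, `b` for `𝒵`). [this work] -/
def val4 (a b : ℕ) : ℤ :=
  -- κ(Q₀,{v})
  (cc a b 6 6 + cc a b 10 10 - cc a b 6 10 - cc a b 10 6)
  -- κ({d₂,d₃},{v,d₁}), κ({d₁,d₃},{v,d₂}), κ({d₁,d₂},{v,d₃})
  + (cc a b 2 2 + cc a b 7 7 + cc a b 6 6 + cc a b 10 10 - cc a b 2 10 - cc a b 7 6 - cc a b 6 7 - cc a b 10 2)
  + (cc a b 1 1 + cc a b 8 8 + cc a b 6 6 + cc a b 10 10 - cc a b 1 10 - cc a b 8 6 - cc a b 6 8 - cc a b 10 1)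
  + (cc a b 0 0 + cc a b 9 9 + cc a b 6 6 + cc a b 10 10 - cc a b 0 10 - cc a b 9 6 - cc a b 6 9 - cc a b 10 0)
  -- κ({v,d₁},{d₂,d₃}), κ({v,d₂},{d₁,d₃}), κ({v,d₃},{d₁,d₂})
  + (cc a b 3 3 + cc a b 9 9 + cc a b 8 8 + cc a b 10 10 - cc a b 3 10 - cc a b 9 8 - cc a b 8 9 - cc a b 10 3)
  + (cc a b 4 4 + cc a b 9 9 + cc a b 7 7 + cc a b 10 10 - cc a b 4 10 - cc a b 9 7 - cc a b 7 9 - cc a b 10 4)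
  + (cc a b 5 5 + cc a b 8 8 + cc a b 7 7 + cc a b 10 10 - cc a b 5 10 - cc a b 8 7 - cc a b 7 8 - cc a b 10 5)
  -- crossed small members
  + (cc a b 2 3 + cc a b 3 2 + cc a b 1 4 + cc a b 4 1 + cc a b 0 5 + cc a b 5 0)
  -- common 2-subsets of `Q`
  - (cc a b 0 0 + cc a b 1 1 + cc a b 2 2 + cc a b 3 3 + cc a b 4 4 + cc a b 5 5)

/-- The sixteen cover relations among the eleven sets (as bit indices). [this work] -/
def covers : List (ℕ × ℕ) :=
  [(0, 6), (0, 9), (1, 6), (1, 8), (2, 6), (2, 7), (3, 8), (3, 9), (4, 7), (4, 9), (5, 7), (5, 8), (6, 10), (7, 10), (8, 10), (9, 10)]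

/-- A bit mask is monotone if it respects the cover relations (up-closure). [this work] -/
def monoMask (a : ℕ) : Bool := covers.all fun ij => !a.testBit ij.1 || a.testBit ij.2

/-- The `114` monotone bit masks below `2^11`. [this work] -/
def validMasks : List ℕ :=
  [0, 1024, 1088, 1152, 1216, 1220, 1280, 1344, 1346, 1408, 1440, 1472, 1474, 1476, 1478, 1504, 1506, 1508, 1510, 1536, 1600, 1601,
   1664, 1680, 1728, 1729, 1732, 1733, 1744, 1745, 1748, 1749, 1792, 1800, 1856, 1857, 1858, 1859, 1864, 1865, 1866, 1867, 1920, 1928,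
   1936, 1944, 1952, 1960, 1968, 1976, 1984, 1985, 1986, 1987, 1988, 1989, 1990, 1991, 1992, 1993, 1994, 1995, 1996, 1997, 1998, 1999,
   2000, 2001, 2002, 2003, 2004, 2005, 2006, 2007, 2008, 2009, 2010, 2011, 2012, 2013, 2014, 2015, 2016, 2017, 2018, 2019, 2020, 2021,
   2022, 2023, 2024, 2025, 2026, 2027, 2028, 2029, 2030, 2031, 2032, 2033, 2034, 2035, 2036, 2037, 2038, 2039, 2040, 2041, 2042, 2043,
   2044, 2045, 2046, 2047]

/-- Every monotone mask below `2^11` is listed (kernel computation over the `2048` masks). [this work] -/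
theorem validMasks_complete : ∀ a < 2048, monoMask a = true → a ∈ validMasks := by decide +kernel

/-- **The four-point functional is `≥ 0` on every pair of monotone patterns** (kernel computation over the `114²` pairs). [this work] -/
theorem val4_nonneg_of_mem : ∀ a ∈ validMasks, ∀ b ∈ validMasks, 0 ≤ val4 a b := by decide +kernel

/-- The four-point functional is `≥ 0` on monotone masks. [this work] -/
theorem val4_nonneg {a b : ℕ} (ha : a < 2048) (hb : b < 2048) (hma : monoMask a = true) (hmb : monoMask b = true) : 0 ≤ val4 a b :=
  val4_nonneg_of_mem a (validMasks_complete a ha hma) b (validMasks_complete b hb hmb)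

/-! ### Encoding eleven booleans as a bit mask -/

/-- Little-endian bit encoding of a list of booleans. [this work] -/
def enc : List Bool → ℕ
  | [] => 0
  | b :: l => Nat.bit b (enc l)

/-- The bits of `enc l` are the entries of `l`. [this work] -/
theorem testBit_enc : ∀ (l : List Bool) (i : ℕ), (enc l).testBit i = l.getD i false
  | [], i => by simp [enc]
  | b :: l, 0 => by rw [enc, Nat.testBit_bit_zero, List.getD_cons_zero]
  | b :: l, i + 1 => by rw [enc, Nat.testBit_bit_succ, testBit_enc l i, List.getD_cons_succ]

/-- `enc l < 2^{#l}`. [this work] -/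
theorem enc_lt : ∀ l : List Bool, enc l < 2 ^ l.length
  | [] => by simp [enc]
  | b :: l => by
    have ih := enc_lt l
    rw [enc, List.length_cons, pow_succ, Nat.bit_val]
    cases b <;> simp <;> omega


/-- `0/1` of two booleans both true. [this work] -/
def ib (p q : Bool) : ℤ := if p && q then 1 else 0

/-- `val4` on encoded lists of eleven booleans, decoded. [this work] -/
theorem val4_enc (b0 b1 b2 b3 b4 b5 b6 b7 b8 b9 b10 c0 c1 c2 c3 c4 c5 c6 c7 c8 c9 c10 : Bool) :
    val4 (enc [b0, b1, b2, b3, b4, b5, b6, b7, b8, b9, b10]) (enc [c0, c1, c2, c3, c4, c5, c6, c7, c8, c9, c10]) =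
  (ib b6 c6 + ib b10 c10 - ib b6 c10 - ib b10 c6)
  + (ib b2 c2 + ib b7 c7 + ib b6 c6 + ib b10 c10 - ib b2 c10 - ib b7 c6 - ib b6 c7 - ib b10 c2)
  + (ib b1 c1 + ib b8 c8 + ib b6 c6 + ib b10 c10 - ib b1 c10 - ib b8 c6 - ib b6 c8 - ib b10 c1)
  + (ib b0 c0 + ib b9 c9 + ib b6 c6 + ib b10 c10 - ib b0 c10 - ib b9 c6 - ib b6 c9 - ib b10 c0)
  + (ib b3 c3 + ib b9 c9 + ib b8 c8 + ib b10 c10 - ib b3 c10 - ib b9 c8 - ib b8 c9 - ib b10 c3)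
  + (ib b4 c4 + ib b9 c9 + ib b7 c7 + ib b10 c10 - ib b4 c10 - ib b9 c7 - ib b7 c9 - ib b10 c4)
  + (ib b5 c5 + ib b8 c8 + ib b7 c7 + ib b10 c10 - ib b5 c10 - ib b8 c7 - ib b7 c8 - ib b10 c5)
  + (ib b2 c3 + ib b3 c2 + ib b1 c4 + ib b4 c1 + ib b0 c5 + ib b5 c0)
  - (ib b0 c0 + ib b1 c1 + ib b2 c2 + ib b3 c3 + ib b4 c4 + ib b5 c5) := by
  simp only [val4, cc, ib, testBit_enc, List.getD_cons_zero, List.getD_cons_succ]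

end FourPt

/-! ### The four-point inequality for up-sets -/

section FourPoint
variable {F G : Finset (Finset α)}

set_option maxHeartbeats 400000 in
/-- **THE FOUR-POINT INEQUALITY.**  For up-sets `𝒳, 𝒵` and four distinct points `v, d₁, d₂, d₃`, the Kleitman surpluses on the seven small cubes
`(Q₀,{v})`, `(Q₀−d,{v,d})`, `({v,d},Q₀−d)` plus the six crossed small members dominate the number of common 2-subsets of `Q = {v,d₁,d₂,d₃}`:
this is the coefficient `[s^m]` (`m = 2·1_{Q₀}`) of the C2 difference of `R_3` at `v` for the pair restricted to `Q`, and the base case of row 3 of C2 at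
level 3 (memo g43 §4). [this work] -/
theorem fourPoint_nonneg (hF : IsUpperSet (F : Set (Finset α))) (hG : IsUpperSet (G : Set (Finset α))) {v d₁ d₂ d₃ : α}
    (h01 : v ≠ d₁) (h02 : v ≠ d₂) (h03 : v ≠ d₃) (h12 : d₁ ≠ d₂) (h13 : d₁ ≠ d₃) (h23 : d₂ ≠ d₃) :
    0 ≤ kap F G {d₁, d₂, d₃} {v}
      + (kap F G {d₂, d₃} {v, d₁} + kap F G {d₁, d₃} {v, d₂} + kap F G {d₁, d₂} {v, d₃})
      + (kap F G {v, d₁} {d₂, d₃} + kap F G {v, d₂} {d₁, d₃} + kap F G {v, d₃} {d₁, d₂})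
      + ((if ({d₂, d₃} : Finset α) ∈ F ∧ ({v, d₁} : Finset α) ∈ G then (1 : ℤ) else 0)
        + (if ({v, d₁} : Finset α) ∈ F ∧ ({d₂, d₃} : Finset α) ∈ G then (1 : ℤ) else 0)
        + (if ({d₁, d₃} : Finset α) ∈ F ∧ ({v, d₂} : Finset α) ∈ G then (1 : ℤ) else 0)
        + (if ({v, d₂} : Finset α) ∈ F ∧ ({d₁, d₃} : Finset α) ∈ G then (1 : ℤ) else 0)
        + (if ({d₁, d₂} : Finset α) ∈ F ∧ ({v, d₃} : Finset α) ∈ G then (1 : ℤ) else 0)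
        + (if ({v, d₃} : Finset α) ∈ F ∧ ({d₁, d₂} : Finset α) ∈ G then (1 : ℤ) else 0))
      - ((if ({d₁, d₂} : Finset α) ∈ F ∧ ({d₁, d₂} : Finset α) ∈ G then (1 : ℤ) else 0)
        + (if ({d₁, d₃} : Finset α) ∈ F ∧ ({d₁, d₃} : Finset α) ∈ G then (1 : ℤ) else 0)
        + (if ({d₂, d₃} : Finset α) ∈ F ∧ ({d₂, d₃} : Finset α) ∈ G then (1 : ℤ) else 0)
        + (if ({v, d₁} : Finset α) ∈ F ∧ ({v, d₁} : Finset α) ∈ G then (1 : ℤ) else 0)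
        + (if ({v, d₂} : Finset α) ∈ F ∧ ({v, d₂} : Finset α) ∈ G then (1 : ℤ) else 0)
        + (if ({v, d₃} : Finset α) ∈ F ∧ ({v, d₃} : Finset α) ∈ G then (1 : ℤ) else 0)) := by
  -- the eleven sets, canonical spellings
  have s2a : insert d₂ ({d₁, d₃} : Finset α) = {d₁, d₂, d₃} := by
    ext x; simp only [mem_insert, mem_singleton]; tauto
  have s2b : insert v (insert d₂ ({d₁, d₃} : Finset α)) = {v, d₁, d₂, d₃} := by rw [s2a]
  have s3a : insert d₃ ({d₁, d₂} : Finset α) = {d₁, d₂, d₃} := by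
    ext x; simp only [mem_insert, mem_singleton]; tauto
  have s3b : insert v (insert d₃ ({d₁, d₂} : Finset α)) = {v, d₁, d₂, d₃} := by rw [s3a]
  have l1a : insert d₂ ({v, d₁} : Finset α) = {v, d₁, d₂} := by
    ext x; simp only [mem_insert, mem_singleton]; tauto
  have l1b : insert d₃ ({v, d₁} : Finset α) = {v, d₁, d₃} := by
    ext x; simp only [mem_insert, mem_singleton]; tauto
  have l1c : insert d₂ (insert d₃ ({v, d₁} : Finset α)) = {v, d₁, d₂, d₃} := by
    ext x; simp only [mem_insert, mem_singleton]; tauto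
  have l2a : insert d₁ ({v, d₂} : Finset α) = {v, d₁, d₂} := by
    ext x; simp only [mem_insert, mem_singleton]; tauto
  have l2b : insert d₃ ({v, d₂} : Finset α) = {v, d₂, d₃} := by
    ext x; simp only [mem_insert, mem_singleton]; tauto
  have l2c : insert d₁ (insert d₃ ({v, d₂} : Finset α)) = {v, d₁, d₂, d₃} := by
    ext x; simp only [mem_insert, mem_singleton]; tauto
  have l3a : insert d₁ ({v, d₃} : Finset α) = {v, d₁, d₃} := by
    ext x; simp only [mem_insert, mem_singleton]; tauto
  have l3b : insert d₂ ({v, d₃} : Finset α) = {v, d₂, d₃} := by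
    ext x; simp only [mem_insert, mem_singleton]; tauto
  have l3c : insert d₁ (insert d₂ ({v, d₃} : Finset α)) = {v, d₁, d₂, d₃} := by
    ext x; simp only [mem_insert, mem_singleton]; tauto
  rw [kap_free_singleton, kap_free_pair F G _ h01, kap_free_pair F G _ h02, kap_free_pair F G _ h03,
    kap_free_pair F G _ h23, kap_free_pair F G _ h13, kap_free_pair F G _ h12,
    s2b, s2a, s3b, s3a, l1c, l1a, l1b, l2c, l2a, l2b, l3c, l3a, l3b]
  -- encode the memberships of the eleven sets
  set lF : List Bool := [decide (({d₁, d₂} : Finset α) ∈ F), decide (({d₁, d₃} : Finset α) ∈ F), decide (({d₂, d₃} : Finset α) ∈ F),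
    decide (({v, d₁} : Finset α) ∈ F), decide (({v, d₂} : Finset α) ∈ F), decide (({v, d₃} : Finset α) ∈ F),
    decide (({d₁, d₂, d₃} : Finset α) ∈ F), decide (({v, d₂, d₃} : Finset α) ∈ F), decide (({v, d₁, d₃} : Finset α) ∈ F),
    decide (({v, d₁, d₂} : Finset α) ∈ F), decide (({v, d₁, d₂, d₃} : Finset α) ∈ F)] with hlF
  set lG : List Bool := [decide (({d₁, d₂} : Finset α) ∈ G), decide (({d₁, d₃} : Finset α) ∈ G), decide (({d₂, d₃} : Finset α) ∈ G),
    decide (({v, d₁} : Finset α) ∈ G), decide (({v, d₂} : Finset α) ∈ G), decide (({v, d₃} : Finset α) ∈ G),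
    decide (({d₁, d₂, d₃} : Finset α) ∈ G), decide (({v, d₂, d₃} : Finset α) ∈ G), decide (({v, d₁, d₃} : Finset α) ∈ G),
    decide (({v, d₁, d₂} : Finset α) ∈ G), decide (({v, d₁, d₂, d₃} : Finset α) ∈ G)] with hlG
  -- monotonicity of the two masks
  have sub06 : ({d₁, d₂} : Finset α) ⊆ {d₁, d₂, d₃} := by intro x; simp only [mem_insert, mem_singleton]; tauto
  have sub09 : ({d₁, d₂} : Finset α) ⊆ {v, d₁, d₂} := by intro x; simp only [mem_insert, mem_singleton]; tauto
  have sub16 : ({d₁, d₃} : Finset α) ⊆ {d₁, d₂, d₃} := by intro x; simp only [mem_insert, mem_singleton]; tauto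
  have sub18 : ({d₁, d₃} : Finset α) ⊆ {v, d₁, d₃} := by intro x; simp only [mem_insert, mem_singleton]; tauto
  have sub26 : ({d₂, d₃} : Finset α) ⊆ {d₁, d₂, d₃} := by intro x; simp only [mem_insert, mem_singleton]; tauto
  have sub27 : ({d₂, d₃} : Finset α) ⊆ {v, d₂, d₃} := by intro x; simp only [mem_insert, mem_singleton]; tauto
  have sub38 : ({v, d₁} : Finset α) ⊆ {v, d₁, d₃} := by intro x; simp only [mem_insert, mem_singleton]; tauto
  have sub39 : ({v, d₁} : Finset α) ⊆ {v, d₁, d₂} := by intro x; simp only [mem_insert, mem_singleton]; tauto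
  have sub47 : ({v, d₂} : Finset α) ⊆ {v, d₂, d₃} := by intro x; simp only [mem_insert, mem_singleton]; tauto
  have sub49 : ({v, d₂} : Finset α) ⊆ {v, d₁, d₂} := by intro x; simp only [mem_insert, mem_singleton]; tauto
  have sub57 : ({v, d₃} : Finset α) ⊆ {v, d₂, d₃} := by intro x; simp only [mem_insert, mem_singleton]; tauto
  have sub58 : ({v, d₃} : Finset α) ⊆ {v, d₁, d₃} := by intro x; simp only [mem_insert, mem_singleton]; tauto
  have sub610 : ({d₁, d₂, d₃} : Finset α) ⊆ {v, d₁, d₂, d₃} := by intro x; simp only [mem_insert, mem_singleton]; tauto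
  have sub710 : ({v, d₂, d₃} : Finset α) ⊆ {v, d₁, d₂, d₃} := by intro x; simp only [mem_insert, mem_singleton]; tauto
  have sub810 : ({v, d₁, d₃} : Finset α) ⊆ {v, d₁, d₂, d₃} := by intro x; simp only [mem_insert, mem_singleton]; tauto
  have sub910 : ({v, d₁, d₂} : Finset α) ⊆ {v, d₁, d₂, d₃} := by intro x; simp only [mem_insert, mem_singleton]; tauto
  have mono : ∀ {K : Finset (Finset α)}, IsUpperSet (K : Set (Finset α)) →
      FourPt.monoMask (FourPt.enc [decide (({d₁, d₂} : Finset α) ∈ K), decide (({d₁, d₃} : Finset α) ∈ K),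
        decide (({d₂, d₃} : Finset α) ∈ K), decide (({v, d₁} : Finset α) ∈ K), decide (({v, d₂} : Finset α) ∈ K),
        decide (({v, d₃} : Finset α) ∈ K), decide (({d₁, d₂, d₃} : Finset α) ∈ K), decide (({v, d₂, d₃} : Finset α) ∈ K),
        decide (({v, d₁, d₃} : Finset α) ∈ K), decide (({v, d₁, d₂} : Finset α) ∈ K), decide (({v, d₁, d₂, d₃} : Finset α) ∈ K)]) = true := by
    intro K hK
    have up : ∀ {S T : Finset α}, S ⊆ T → S ∈ K → T ∈ K := fun hST hS => hK hST hS
    simp only [FourPt.monoMask, FourPt.covers, List.all_cons, List.all_nil, Bool.and_true, FourPt.testBit_enc, List.getD_cons_zero,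
      List.getD_cons_succ, Bool.and_eq_true, Bool.or_eq_true, Bool.not_eq_true', decide_eq_false_iff_not, decide_eq_true_eq]
    refine ⟨?_, ?_, ?_, ?_, ?_, ?_, ?_, ?_, ?_, ?_, ?_, ?_, ?_, ?_, ?_, ?_⟩ <;> first
      | exact (em _).symm.imp id (up sub06) | exact (em _).symm.imp id (up sub09) | exact (em _).symm.imp id (up sub16)
      | exact (em _).symm.imp id (up sub18) | exact (em _).symm.imp id (up sub26) | exact (em _).symm.imp id (up sub27)
      | exact (em _).symm.imp id (up sub38) | exact (em _).symm.imp id (up sub39) | exact (em _).symm.imp id (up sub47)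
      | exact (em _).symm.imp id (up sub49) | exact (em _).symm.imp id (up sub57) | exact (em _).symm.imp id (up sub58)
      | exact (em _).symm.imp id (up sub610) | exact (em _).symm.imp id (up sub710) | exact (em _).symm.imp id (up sub810)
      | exact (em _).symm.imp id (up sub910)
  have hla : FourPt.enc lF < 2048 := by have := FourPt.enc_lt lF; rw [hlF] at this ⊢; simpa using this
  have hlb : FourPt.enc lG < 2048 := by have := FourPt.enc_lt lG; rw [hlG] at this ⊢; simpa using this
  have key := FourPt.val4_nonneg hla hlb (mono hF) (mono hG)
  rw [hlF, hlG, FourPt.val4_enc] at key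
  simp only [FourPt.ib, Bool.and_eq_true, decide_eq_true_eq] at key
  refine le_of_le_of_eq key ?_
  ring

end FourPoint

end Summit.CriticalPhenomena.PercolationContinuityZ3.Theorems.SahiCTCForms
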